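import Literature.MathematicalPhysics.QuantumFieldTheory.Balaban1983to89.B4GaussRep36

/-!
# `Balaban1983to89.B4GaussRep36Proof` — T. Bałaban, *Regularity and decay of lattice Green's functions*, Commun.
# Math. Phys. **89** (1983) 571–597 [Balaban1983RegularityDecay], Sect. 3 (3.6) p. 588: the Gaussian representation
# of the unit-lattice covariance `C^{(k)}_Λ(Ω,A)` — KERNEL-PROVED for the plain-matrix typing `B4GaussRep36.Rep36`

statement-level skeleton of published theorems with citation tags; proofs where landed; nothing here is a claim about the Yang–Mills mass gap

CITATION HEADER (lean-in-tree rule).  lit-balaban cell (HOME `run/shared/lean/pub/lit-balaban/`), SKELETON row `B4.Eq3.6`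
(nominated `PHASE2-NOMINATE B4.Eq3.6` by unit lit-balaban-r01); statement file `…Balaban1983to89.B4GaussRep36`
(p238964), whose `Rep36` is proved here AS TYPED, with no change to that module.  THE PRINT (p. 588 [PDF 18], verbatim,
×2 render `…/pages/1983-cmp89-regularity-decay/1983-cmp89-regularity-decay-p018-x2.png`): *"we have finally
C^{(k)}_Λ(Ω,A;y,y') = ([−(a_{k+1}/a_k)L^{−2}Q*(A)Q_{k+1}(A) + Q_k(A)]G_k(Ω,Λ,A)·[−(a_{k+1}/a_k)L^{−2}Q*_{k+1}(A)Q(A) +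
Q*_k(A)])(y,y') − (a_{k+1}/a_k²)L^{−2}P(A;y,y') + δ_{y,y'}/a_k. (3.6)"*, derived in print from the Gaussian integrals
(3.1)–(3.4) (translation `ψ → ψ + Q_kφ`, the gauge transformation `ψ(y) → U(A(Γ_{y,z}))ψ(y)` and the blockwise
Gaussian integration (3.3)).

THE PROOF GIVEN HERE (finite-dimensional linear algebra; the Gaussian integrals of the print are replaced by their
algebraic content, the two-way Schur complement / "law of total covariance"):  with `K = H + a_kQ_kᵀQ_k` (1.6),
`P = wQᵀQ`, `D = 1_Λ`, `D' = 1_{Λ'}`, the joint precision matrix of `(φ, ψ_Λ)` is `[[K, −a_kQ_kᵀ|_Λ], [−a_kQ_k|_Λ,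
(a_k + aL^{−2}P)|_Λ]]`; its Schur complement with respect to `K` is `(Δ^{(k)} + aL^{−2}P)|_Λ = (C^{(k)}_Λ)^{−1}` (1.13)–(1.14),
and with respect to the `ψ_Λ`-block it is the two-scale form `K̂_Λ` of (3.5) — the latter because
`((a_k + aL^{−2}P)|_Λ)^{−1} = (a_k^{−1} − (a_{k+1}/a_k²)L^{−2}P)|_Λ` (P a projection by `RowOrtho`, commuting with `1_Λ` by
`BlockCompatible`; cf. (3.3)) and `a_{k+1} = aa_k/(aL^{−2} + a_k)`.  The block-inversion identity
`(C − UA^{−1}Uᵀ)^{−1} = C^{−1} + C^{−1}U(A − UᵀC^{−1}U)^{−1}UᵀC^{−1}` (`inv_schur`, proved from `AA^{−1} = 1` etc.) then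
IS (3.6), the mean map `C^{−1}U = [Q_k − (a_{k+1}/a_k)L^{−2}Q*Q_{k+1}]|_Λ` being the operator `T` of the statement file.
Hypotheses used: `a_k, a, L^{−2}, w > 0`, `RowOrtho`, `BlockCompatible`, positivity of the two forms (invertibility);
the symmetry of `H` is not needed.  Numerical cross-check of the identity on random instances: cell record
`lit-balaban-r01/check36.py` (residual 1e−13).  Nothing of the paper beyond this matrix identity is asserted.
-/

namespace Literature.MathematicalPhysics.QuantumFieldTheory.Balaban1983to89.B4GaussRep36Proof

open Matrix B4GaussRep36

variable {X Y Z : Type*}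

/-! ## Linear-algebra helpers (plain matrices; `[folklore]`) -/

/-- Two-way Schur complement / block inversion: if `A` is invertible, `C·Ci = 1` and the complement
`S = A − UᵀCiU` is invertible, then `(C − UA⁻¹Uᵀ)⁻¹ = Ci + Ci·U·S⁻¹·Uᵀ·Ci`. [folklore] -/
private theorem inv_schur {m n : Type*} [Fintype m] [Fintype n] [DecidableEq m] [DecidableEq n]
    (A : Matrix m m ℝ) (U : Matrix n m ℝ) (C Ci : Matrix n n ℝ) (hA : IsUnit A) (hC : C * Ci = 1)
    (hS : IsUnit (A - Uᵀ * Ci * U)) :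
    (C - U * A⁻¹ * Uᵀ)⁻¹ = Ci + Ci * U * (A - Uᵀ * Ci * U)⁻¹ * Uᵀ * Ci := by
  set S : Matrix m m ℝ := A - Uᵀ * Ci * U with hSdef
  have hA' : A⁻¹ * A = 1 := Matrix.nonsing_inv_mul A ((Matrix.isUnit_iff_isUnit_det A).mp hA)
  have hS' : S * S⁻¹ = 1 := Matrix.mul_nonsing_inv S ((Matrix.isUnit_iff_isUnit_det S).mp hS)
  have key : ∀ R : Matrix m n ℝ,
      A⁻¹ * (Uᵀ * (Ci * (U * (S⁻¹ * R)))) = S⁻¹ * R - A⁻¹ * R := by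
    intro R
    have h1 : A⁻¹ * S * (S⁻¹ * R) = A⁻¹ * R := by
      rw [Matrix.mul_assoc, ← Matrix.mul_assoc S, hS', Matrix.one_mul]
    have h2 : A⁻¹ * S = 1 - A⁻¹ * (Uᵀ * (Ci * U)) := by
      rw [hSdef, Matrix.mul_sub, hA', Matrix.mul_assoc]
    rw [h2, Matrix.sub_mul, Matrix.one_mul] at h1
    have h3 : A⁻¹ * (Uᵀ * (Ci * U)) * (S⁻¹ * R) = A⁻¹ * (Uᵀ * (Ci * (U * (S⁻¹ * R)))) := by
      simp only [Matrix.mul_assoc]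
    rw [h3] at h1
    rw [eq_sub_iff_add_eq, ← h1]
    abel
  apply Matrix.inv_eq_right_inv
  rw [Matrix.sub_mul, Matrix.mul_add, Matrix.mul_add, hC]
  simp only [Matrix.mul_assoc]
  have hcancel : C * (Ci * (U * (S⁻¹ * (Uᵀ * Ci)))) = U * (S⁻¹ * (Uᵀ * Ci)) := by
    rw [← Matrix.mul_assoc, hC, Matrix.one_mul]
  rw [hcancel, key (Uᵀ * Ci), Matrix.mul_sub]
  abel

/-- `M|_{rows e₁, cols Λ} · N|_{rows Λ, cols e₃} = (M·1_Λ·N)|_{e₁,e₃}` (summing over `Λ` = inserting the indicator).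
[folklore] -/
private theorem submatrix_val_mul [Fintype Y] [DecidableEq Y] {α β ι κ : Type*} (Λ : Finset Y)
    (M : Matrix α Y ℝ) (N : Matrix Y β ℝ) (e₁ : ι → α) (e₃ : κ → β) :
    M.submatrix e₁ (Subtype.val : Λ → Y) * N.submatrix (Subtype.val : Λ → Y) e₃
      = (M * diagInd Λ * N).submatrix e₁ e₃ := by
  ext i j
  rw [Matrix.mul_apply, Matrix.submatrix_apply, Matrix.mul_apply]
  simp only [Matrix.submatrix_apply, diagInd, Matrix.mul_diagonal]
  calc ∑ l : Λ, M (e₁ i) l * N l (e₃ j)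
      = ∑ y ∈ Λ, M (e₁ i) y * N y (e₃ j) := Finset.sum_coe_sort Λ (fun y => M (e₁ i) y * N y (e₃ j))
    _ = ∑ y, if y ∈ Λ then M (e₁ i) y * N y (e₃ j) else 0 := by
          rw [Finset.sum_ite_mem, Finset.univ_inter]
    _ = ∑ y, M (e₁ i) y * (if y ∈ Λ then (1 : ℝ) else 0) * N y (e₃ j) :=
          Finset.sum_congr rfl fun y _ => by split_ifs <;> simp

/-- Rows in `Λ` do not see the indicator on the left. [folklore] -/
private theorem submatrix_diagInd_mul [Fintype Y] [DecidableEq Y] {β κ : Type*} (Λ : Finset Y)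
    (R : Matrix Y β ℝ) (e : κ → β) :
    (diagInd Λ * R).submatrix (Subtype.val : Λ → Y) e = R.submatrix Subtype.val e := by
  ext i j
  simp [diagInd, Matrix.diagonal_mul, i.2]

/-- `1_{Λᶜ} = 1 − 1_Λ`. [folklore] -/
private theorem diagInd_compl [Fintype Y] [DecidableEq Y] (Λ : Finset Y) :
    diagInd Λᶜ = 1 - diagInd Λ := by
  ext i j
  simp only [diagInd, Matrix.sub_apply, Matrix.diagonal_apply, Matrix.one_apply, Finset.mem_compl]
  split_ifs <;> simp_all

/-- The indicator restricted to `Λ × Λ` is the identity. [folklore] -/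
private theorem diagInd_submatrix_val [Fintype Y] [DecidableEq Y] (Λ : Finset Y) :
    (diagInd Λ).submatrix (Subtype.val : Λ → Y) (Subtype.val : Λ → Y) = 1 := by
  ext i j
  rcases i with ⟨i, hi⟩
  rcases j with ⟨j, hj⟩
  by_cases h : i = j
  · subst h
    simp [diagInd, hi]
  · have h' : (⟨i, hi⟩ : Λ) ≠ ⟨j, hj⟩ := fun e => h (congrArg Subtype.val e)
    simp [diagInd, h, h']

/-- Products through an `id`-reindexed middle factor. [folklore] -/
private theorem submatrix_id_mul_mul_submatrix_id [Fintype X] {κ κ' : Type*} (A : Matrix Y X ℝ)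
    (G : Matrix X X ℝ) (B : Matrix X Y ℝ) (e : κ → Y) (e' : κ' → Y) :
    A.submatrix e id * G * B.submatrix id e' = (A * G * B).submatrix e e' := by
  ext i j
  simp only [Matrix.mul_apply, Matrix.submatrix_apply, id_eq]

/-- Applied form of `Matrix.submatrix_smul` (Mathlib states these at function level). [folklore] -/
private theorem sm_smul {m n l o : Type*} (r : ℝ) (A : Matrix m n ℝ) (e : l → m) (f : o → n) :
    (r • A).submatrix e f = r • A.submatrix e f := rfl

/-- Applied form of `Matrix.submatrix_sub`. [folklore] -/
private theorem sm_sub {m n l o : Type*} (A B : Matrix m n ℝ) (e : l → m) (f : o → n) :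
    (A - B).submatrix e f = A.submatrix e f - B.submatrix e f := rfl

/-- Applied form of `Matrix.submatrix_add`. [folklore] -/
private theorem sm_add {m n l o : Type*} (A B : Matrix m n ℝ) (e : l → m) (f : o → n) :
    (A + B).submatrix e f = A.submatrix e f + B.submatrix e f := rfl

/-- Polynomial calculus for a projection: `(α + βP)(γ + δP) = αγ + (αδ + βγ + βδ)P`. [folklore] -/
private theorem proj_poly_mul [Fintype Y] [DecidableEq Y] (P : Matrix Y Y ℝ) (hPP : P * P = P)
    (α β γ δ : ℝ) :
    (α • (1 : Matrix Y Y ℝ) + β • P) * (γ • (1 : Matrix Y Y ℝ) + δ • P)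
      = (α * γ) • (1 : Matrix Y Y ℝ) + (α * δ + β * γ + β * δ) • P := by
  rw [Matrix.add_mul, Matrix.mul_add, Matrix.mul_add, Matrix.smul_mul, Matrix.smul_mul, Matrix.smul_mul,
    Matrix.smul_mul, Matrix.one_mul, Matrix.one_mul, Matrix.mul_smul, Matrix.mul_smul, Matrix.mul_one, hPP,
    smul_smul, smul_smul, smul_smul, smul_smul, add_smul, add_smul]
  abel

/-- `RowOrtho` makes `P = wQᵀQ` a projection. [folklore] -/
private theorem pOp_mul_pOp [Fintype Y] [Fintype Z] [DecidableEq Z] {w : ℝ} {Q : Matrix Z Y ℝ}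
    (hQ : RowOrtho w Q) (hw : w ≠ 0) : pOp w Q * pOp w Q = pOp w Q := by
  unfold RowOrtho at hQ
  unfold pOp
  rw [Matrix.smul_mul, Matrix.mul_smul, smul_smul, Matrix.mul_assoc, ← Matrix.mul_assoc Q, hQ,
    Matrix.smul_mul, Matrix.one_mul, Matrix.mul_smul, smul_smul]
  congr 1
  field_simp

/-- `BlockCompatible`: the indicator of `Λ'` between `Qᵀ` and `Q` is the indicator of `Λ` outside (left form).
[folklore] -/
private theorem transpose_diagInd_mul_left [Fintype Y] [Fintype Z] [DecidableEq Y] [DecidableEq Z]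
    {Q : Matrix Z Y ℝ} {Λ : Finset Y} {Λ' : Finset Z} (hB : BlockCompatible Q Λ Λ') :
    Qᵀ * diagInd Λ' * Q = diagInd Λ * (Qᵀ * Q) := by
  ext y y'
  unfold diagInd
  rw [Matrix.mul_apply, Matrix.diagonal_mul, Matrix.mul_apply, Finset.mul_sum]
  simp only [Matrix.mul_diagonal, Matrix.transpose_apply]
  refine Finset.sum_congr rfl fun z _ => ?_
  by_cases hq : Q z y = 0
  · simp [hq]
  · have hiff := hB z y hq
    by_cases hy : y ∈ Λ
    · have hz : z ∈ Λ' := hiff.mp hy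
      simp [hy, hz]
    · have hz : z ∉ Λ' := fun hz => hy (hiff.mpr hz)
      simp [hy, hz]

/-- `BlockCompatible`, right form. [folklore] -/
private theorem transpose_diagInd_mul_right [Fintype Y] [Fintype Z] [DecidableEq Y] [DecidableEq Z]
    {Q : Matrix Z Y ℝ} {Λ : Finset Y} {Λ' : Finset Z} (hB : BlockCompatible Q Λ Λ') :
    Qᵀ * diagInd Λ' * Q = (Qᵀ * Q) * diagInd Λ := by
  ext y y'
  unfold diagInd
  rw [Matrix.mul_apply, Matrix.mul_diagonal, Matrix.mul_apply, Finset.sum_mul]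
  simp only [Matrix.mul_diagonal, Matrix.transpose_apply]
  refine Finset.sum_congr rfl fun z _ => ?_
  by_cases hq : Q z y' = 0
  · simp [hq]
  · have hiff := hB z y' hq
    by_cases hy : y' ∈ Λ
    · have hz : z ∈ Λ' := hiff.mp hy
      simp [hy, hz]
    · have hz : z ∉ Λ' := fun hz => hy (hiff.mpr hz)
      simp [hy, hz]

/-! ## (3.6) -/

/-- **(3.6)** p. 588, KERNEL-PROVED for the plain-matrix typing of the statement file: `B4GaussRep36.Rep36` holds for
every family of data (two-way Schur complement, see the module docstring). [cite: Balaban1983RegularityDecay, (3.6) p.588] -/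
theorem rep36 [Fintype X] [Fintype Y] [Fintype Z] [DecidableEq X] [DecidableEq Y] [DecidableEq Z]
    (H : Matrix X X ℝ) (ak : ℝ) (Qk : Matrix Y X ℝ) (a ℓ w : ℝ) (Q : Matrix Z Y ℝ) (Λ : Finset Y)
    (Λ' : Finset Z) : Rep36 H ak Qk a ℓ w Q Λ Λ' := by
  intro _ hak ha hℓ hw hQ hB hK hKΛ
  -- names
  set a' : ℝ := aNext a ak ℓ with ha'def
  set P : Matrix Y Y ℝ := pOp w Q with hPdef
  set D : Matrix Y Y ℝ := diagInd Λ with hDdef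
  set K : Matrix X X ℝ := kForm H ak Qk with hKdef
  set M : Matrix Y Y ℝ := ak • (1 : Matrix Y Y ℝ) + (a * ℓ) • P with hMdef
  set N : Matrix Y Y ℝ := (1 / ak) • (1 : Matrix Y Y ℝ) + (-(a' / ak ^ 2 * ℓ)) • P with hNdef
  set U : Matrix Λ X ℝ := ak • Qk.submatrix (Subtype.val : Λ → Y) id with hUdef
  set Cm : Matrix Λ Λ ℝ := M.submatrix (Subtype.val : Λ → Y) Subtype.val with hCmdef
  set Ci : Matrix Λ Λ ℝ := N.submatrix (Subtype.val : Λ → Y) Subtype.val with hCidef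
  -- scalar facts
  have hak0 : ak ≠ 0 := hak.ne'
  have hden : a * ℓ + ak ≠ 0 := (add_pos (mul_pos ha hℓ) hak).ne'
  have ha'eq : a' = a * ak / (a * ℓ + ak) := by rw [ha'def, aNext]
  -- P is a symmetric projection commuting with D
  have hPP : P * P = P := pOp_mul_pOp hQ hw.ne'
  have hDP : D * P = P * D := by
    rw [hPdef, pOp, Matrix.mul_smul, Matrix.smul_mul, ← transpose_diagInd_mul_left hB,
      transpose_diagInd_mul_right hB]
  have hPt : Pᵀ = P := by
    rw [hPdef, pOp, Matrix.transpose_smul, Matrix.transpose_mul, Matrix.transpose_transpose]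
  -- M·N = 1 and commutation with D
  have hMN : M * N = 1 := by
    have hc0 : ak * -(a' / ak ^ 2 * ℓ) + a * ℓ * (1 / ak) + a * ℓ * -(a' / ak ^ 2 * ℓ) = 0 := by
      rw [ha'eq]
      field_simp
      ring
    rw [hMdef, hNdef, proj_poly_mul P hPP, mul_one_div_cancel hak0, one_smul, hc0, zero_smul, add_zero]
  have hMD : M * D = D * M := by
    rw [hMdef, Matrix.add_mul, Matrix.mul_add, Matrix.smul_mul, Matrix.smul_mul, Matrix.mul_smul,
      Matrix.mul_smul, Matrix.one_mul, Matrix.mul_one, hDP]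
  have hND : N * D = D * N := by
    rw [hNdef, Matrix.add_mul, Matrix.mul_add, Matrix.smul_mul, Matrix.smul_mul, Matrix.mul_smul,
      Matrix.mul_smul, Matrix.one_mul, Matrix.mul_one, hDP]
  -- (E2) Cm · Ci = 1
  have hCmCi : Cm * Ci = 1 := by
    rw [hCmdef, hCidef, submatrix_val_mul, ← hDdef, hMD, Matrix.mul_assoc, hMN, Matrix.mul_one, hDdef,
      diagInd_submatrix_val]
  -- (E1) the Schur complement w.r.t. K is (Δ^{(k)} + aℓP)|_Λ
  have hU : U * K⁻¹ * Uᵀ = (ak * ak) • (Qk * K⁻¹ * Qkᵀ).submatrix (Subtype.val : Λ → Y) Subtype.val := by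
    rw [hUdef, Matrix.transpose_smul, Matrix.transpose_submatrix]
    simp only [Matrix.smul_mul, Matrix.mul_smul, smul_smul]
    rw [submatrix_id_mul_mul_submatrix_id]
  have hE1 : cOpLam H ak Qk a ℓ w Q Λ = Cm - U * K⁻¹ * Uᵀ := by
    rw [hU, hCmdef, hMdef]
    unfold cOpLam deltaK gk
    rw [← hKdef, ← hPdef]
    ext i j
    simp only [Matrix.submatrix_apply, Matrix.sub_apply, Matrix.add_apply, Matrix.smul_apply,
      smul_eq_mul]
    ring
  -- (E3) the Schur complement w.r.t. the ψ_Λ-block is K̂_Λ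
  have hCiU : Ci * U = (Qk + (-(a' / ak * ℓ)) • (P * Qk)).submatrix (Subtype.val : Λ → Y) id := by
    rw [hCidef, hUdef, Matrix.mul_smul, submatrix_val_mul, ← hDdef, hND, Matrix.mul_assoc, hDdef,
      submatrix_diagInd_mul, ← sm_smul, ← Matrix.smul_mul, hNdef, smul_add, smul_smul, smul_smul,
      mul_one_div_cancel hak0, one_smul, Matrix.add_mul, Matrix.one_mul, Matrix.smul_mul]
    have : ak * -(a' / ak ^ 2 * ℓ) = -(a' / ak * ℓ) := by
      field_simp
    rw [this]
  have hUCU : Uᵀ * Ci * U = ak • (Qkᵀ * D * Qk) - (a' * ℓ) • (Qkᵀ * D * (P * Qk)) := by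
    rw [Matrix.mul_assoc, hCiU, hUdef, Matrix.transpose_smul, Matrix.transpose_submatrix,
      Matrix.smul_mul, submatrix_val_mul, Matrix.submatrix_id_id, ← hDdef, Matrix.mul_add,
      Matrix.mul_smul, smul_add, smul_smul]
    have : ak * -(a' / ak * ℓ) = -(a' * ℓ) := by
      field_simp
    rw [this, neg_smul, ← sub_eq_add_neg]
  have h3 : (a' * w * ℓ) • ((Q * Qk)ᵀ * diagInd Λ' * (Q * Qk)) = (a' * ℓ) • (Qkᵀ * D * (P * Qk)) := by
    rw [Matrix.transpose_mul, Matrix.mul_assoc Qkᵀ Qᵀ (diagInd Λ'), Matrix.mul_assoc Qkᵀ,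
      ← Matrix.mul_assoc (Qᵀ * diagInd Λ') Q Qk, transpose_diagInd_mul_left hB, ← hDdef, hPdef, pOp]
    simp only [Matrix.mul_assoc, Matrix.mul_smul, Matrix.smul_mul, smul_smul]
    congr 1
    ring
  have hE3 : K - Uᵀ * Ci * U = kLam H ak Qk a ℓ w Q Λ Λ' := by
    rw [hUCU, kLam, qNext, ← ha'def, h3, diagInd_compl, ← hDdef, Matrix.mul_sub, Matrix.mul_one,
      Matrix.sub_mul, smul_sub, hKdef, kForm]
    abel
  -- invertibility
  have hKu : IsUnit K := hK.isUnit
  have hSu : IsUnit (K - Uᵀ * Ci * U) := by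
    rw [hE3]
    exact hKΛ.isUnit
  -- (E5) assemble
  have hCit : Ciᵀ = Ci := by
    rw [hCidef, Matrix.transpose_submatrix, hNdef, Matrix.transpose_add, Matrix.transpose_smul,
      Matrix.transpose_smul, Matrix.transpose_one, hPt]
  have hT : tOp ak Qk a ℓ w Q Λ Λ' = Ci * U := by
    rw [hCiU, tOp, qNext, ← ha'def, ← Matrix.mul_assoc (Qᵀ * diagInd Λ') Q Qk,
      transpose_diagInd_mul_left hB, ← hDdef, sm_sub, sm_add, sm_smul, sm_smul, Matrix.mul_assoc D,
      submatrix_diagInd_mul, hPdef, pOp, Matrix.smul_mul, sm_smul, smul_smul,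
      show -(a' / ak * ℓ) * w = -(a' / ak * w * ℓ) by ring, neg_smul, sub_eq_add_neg]
  have hCi : Ci = (1 / ak) • (1 : Matrix Λ Λ ℝ)
      + (-(a' / ak ^ 2 * ℓ)) • P.submatrix (Subtype.val : Λ → Y) Subtype.val := by
    rw [hCidef, hNdef, sm_add, sm_smul, sm_smul, Matrix.submatrix_one _ Subtype.val_injective]
  unfold cLam
  rw [hE1, inv_schur K U Cm Ci hKu hCmCi hSu, hE3, rep36Rhs, gLam, hT, Matrix.transpose_mul, hCit,
    ← ha'def, ← hPdef, hCi]
  simp only [Matrix.mul_assoc, neg_smul]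
  abel

end Literature.MathematicalPhysics.QuantumFieldTheory.Balaban1983to89.B4GaussRep36Proof
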